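import Summits.BirchSwinnertonDyer.BirchSwinnertonDyer.Theorems.ClassRecordThreeEulerHalvesAtThreeCartanSupplyVirtualCharacter
import HarnessLib

/-!
# Crux 23422 line `cartan` v11, stub SUPPLY (`CartanTorusLatticeSupply`), road C1 — the GENERIC ENGINE, part 2:
# the two character sums (α), (β) of an irreducible character with one-dimensional commutant, WITHOUT decomposing `V`

Seat `bsd-idea-10` (g13), `--supports stmt-BirchSwinnertonDyer-19109 --as helper`; continues `…CartanSupplyVirtualCharacter` (part 1: a virtual
character `f = χ_A − χ_B` of norm one and positive degree is the character of an irreducible `U` with `End_G(U) = k`). Over any field `k` of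
characteristic zero, for a representation `U` with `finrank End_G(U) = 1` and `Σ_g χ_U(g)χ_U(g⁻¹) = |G|`:
* §4 the CLASS OPERATOR `z_f = Σ_h f(h⁻¹) ρ(h)` of a class function (an intertwiner, `classOp`) and its traces;
* §5 (α) `alpha_sum`: `χ(1)·Σ_h χ(h⁻¹)χ(hx) = |G|·χ(x)` — `z_χ` on `U` is a scalar `c` (one-dimensional commutant), `c·χ(1) = tr z_χ = |G|`;
  (β) `beta_sum` (now `U` irreducible): for every `V` with `Σ_h χ(h⁻¹)χ_V(h) = |G|` ("multiplicity one"), `χ(1)·Σ_h χ(h⁻¹)χ_V(gh) = |G|·χ(g)` —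
  `P = (χ(1)∕|G|)·z_χ` is an idempotent intertwiner of `V` (by (α)), `χ_{range P}(y) = tr(ρ_V(y)P)`, `dim range P = χ(1)` and
  `⟨χ_{range P}, χ⟩ = 1` by traces, so a non-zero intertwiner `U → range P` exists, is injective by irreducibility and bijective by dimension:
  `χ = χ_{range P}`, which is the claim. No decomposition of `V` into irreducibles, no algebraic closure.
Part 3 (`…CartanSupplyVirtualSupply`) packages (α), (β) for `GL₂(𝔽_q)`, `χ = χ_W`, `V = k[G ∕ T]` into `CartanConvolutionSupply`.
HONEST FRAMING: generic finite-group representation theory only; no statement about `cubicNewvectorChar`, no route item, no summit statement is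
proved here. [cite: SerreLinearRepresentations1977, §2.3 & §2.6 Thm. 8] [folklore]
-/

set_option linter.dupNamespace false
set_option autoImplicit false

noncomputable section

namespace Summit.BirchSwinnertonDyer.BirchSwinnertonDyer.Theorems.CartanSupply.VirtualCharacter

open Module Representation

/-! ## §4 The class operator `z_f = Σ_h f(h⁻¹) ρ(h)` -/

section classOp

variable {k : Type*} [Field k] {G : Type*} [Group G] [Fintype G]
  {V : Type*} [AddCommGroup V] [Module k V] (ρ : Representation k G V)

/-- The CLASS OPERATOR `z_f = Σ_h f(h⁻¹) ρ(h)` of a class function `f`, an intertwining map (`Σ_h f(h⁻¹) ρ(hg) = Σ_h f(h⁻¹) ρ(gh)`, both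
being `Σ_x f(g x⁻¹) ρ(x)`). -/
def classOp (f : G → k) (hcl : ∀ a b, f (a * b) = f (b * a)) : IntertwiningMap ρ ρ where
  toLinearMap := ∑ h, f h⁻¹ • ρ h
  isIntertwining' g := by
    show (∑ h, f h⁻¹ • ρ h) * ρ g = ρ g * ∑ h, f h⁻¹ • ρ h
    rw [Finset.sum_mul, Finset.mul_sum]
    simp only [smul_mul_assoc, mul_smul_comm, ← map_mul]
    have hA : ∑ h, f h⁻¹ • ρ (h * g) = ∑ x, f (x * g⁻¹)⁻¹ • ρ x :=
      Fintype.sum_equiv (Equiv.mulRight g) _ _ (fun h => by simp only [Equiv.coe_mulRight, mul_inv_cancel_right])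
    have hB : ∑ h, f h⁻¹ • ρ (g * h) = ∑ x, f (g⁻¹ * x)⁻¹ • ρ x :=
      Fintype.sum_equiv (Equiv.mulLeft g) _ _ (fun h => by simp only [Equiv.coe_mulLeft, inv_mul_cancel_left])
    rw [hA, hB]
    refine Finset.sum_congr rfl (fun x _ => ?_)
    simp only [mul_inv_rev, inv_inv]
    rw [hcl]

/-- PROVED: the underlying linear map of the class operator. [folklore] -/
theorem classOp_toLinearMap (f : G → k) (hcl : ∀ a b, f (a * b) = f (b * a)) :
    (classOp ρ f hcl).toLinearMap = ∑ h, f h⁻¹ • ρ h := rfl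

/-- PROVED: `tr(ρ(g) · z_f) = Σ_h f(h⁻¹) χ_ρ(gh)`. [folklore] -/
theorem trace_mul_classSum (f : G → k) (g : G) :
    LinearMap.trace k V (ρ g * ∑ h, f h⁻¹ • ρ h) = ∑ h, f h⁻¹ * ρ.character (g * h) := by
  rw [Finset.mul_sum, map_sum]
  refine Finset.sum_congr rfl (fun h _ => ?_)
  rw [mul_smul_comm, map_smul, ← map_mul, smul_eq_mul]
  rfl

/-- PROVED: `tr(z_f) = Σ_h f(h⁻¹) χ_ρ(h)`. [folklore] -/
theorem trace_classSum (f : G → k) :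
    LinearMap.trace k V (∑ h, f h⁻¹ • ρ h) = ∑ h, f h⁻¹ * ρ.character h := by
  have := trace_mul_classSum ρ f 1
  simpa only [map_one, one_mul] using this

end classOp

/-! ## §5 The two sums (α), (β) for a Schurian irreducible character -/

section sums

variable {k : Type*} [Field k] [CharZero k] {G : Type*} [Group G] [Fintype G]
  {U : Type*} [AddCommGroup U] [Module k U] [FiniteDimensional k U] (ρU : Representation k G U)

omit [CharZero k] [Fintype G] [FiniteDimensional k U] in
/-- PROVED: a character is a class function. [folklore] -/
theorem char_mul_comm' (a b : G) : ρU.character (a * b) = ρU.character (b * a) := char_mul_comm ρU b a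

omit [CharZero k] in
/-- PROVED — **(α) THE SCHUR SCALAR**: for a representation `U` with `End_G(U) = k` and `Σ_g χ(g)χ(g⁻¹) = |G|`,
`χ(1) · Σ_h χ(h⁻¹) χ(hx) = |G| · χ(x)` (the class operator `z_χ` is the scalar `|G| ∕ χ(1)`). [cite: SerreLinearRepresentations1977, §2.2 Prop. 4 & §2.6] -/
theorem alpha_sum (hE : finrank k (IntertwiningMap ρU ρU) = 1)
    (hnorm : ∑ g, ρU.character g * ρU.character g⁻¹ = Fintype.card G) (x : G) :
    ρU.character 1 * ∑ h, ρU.character h⁻¹ * ρU.character (h * x) = Fintype.card G * ρU.character x := by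
  haveI : Nontrivial U := nontrivial_of_finrank_intertwiningMap_eq_one ρU hE
  obtain ⟨c, hc⟩ := (finrank_eq_one_iff_of_nonzero' (IntertwiningMap.id ρU) (id_ne_zero ρU)).mp hE
    (classOp ρU ρU.character (char_mul_comm' ρU))
  have hz : (∑ h, ρU.character h⁻¹ • ρU h : Module.End k U) = c • LinearMap.id := by
    have := congrArg IntertwiningMap.toLinearMap hc
    rw [IntertwiningMap.toLinearMap_smul, IntertwiningMap.toLinearMap_id, classOp_toLinearMap] at this
    exact this.symm
  -- traces: `Σ_h χ(h⁻¹)χ(h) = c · χ(1)` and `= |G|`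
  have htr : ∑ h, ρU.character h⁻¹ * ρU.character h = c * ρU.character 1 := by
    rw [← trace_classSum ρU ρU.character, hz, map_smul, LinearMap.trace_id, char_one, smul_eq_mul]
  have hnorm' : ∑ h, ρU.character h⁻¹ * ρU.character h = Fintype.card G := by
    rw [← hnorm]
    exact Finset.sum_congr rfl (fun h _ => mul_comm _ _)
  have hc1 : c * ρU.character 1 = Fintype.card G := by rw [← htr, hnorm']
  -- `tr(ρ(x) z) = c χ(x)`
  have hx : ∑ h, ρU.character h⁻¹ * ρU.character (x * h) = c * ρU.character x := by
    rw [← trace_mul_classSum ρU ρU.character x, hz, mul_smul_comm, Module.End.mul_eq_comp, LinearMap.comp_id, map_smul,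
      smul_eq_mul]
    rfl
  have hx' : ∑ h, ρU.character h⁻¹ * ρU.character (h * x) = c * ρU.character x := by
    rw [← hx]
    exact Finset.sum_congr rfl (fun h _ => by rw [char_mul_comm' ρU h x])
  rw [hx', ← mul_assoc, mul_comm (ρU.character 1) c, hc1]

/-- PROVED — **(β) THE ISOTYPIC PROJECTOR OF MULTIPLICITY ONE**: for an irreducible `U` with `End_G(U) = k`,
`Σ_g χ(g)χ(g⁻¹) = |G|`, and a representation `V` with `Σ_h χ(h⁻¹)χ_V(h) = |G|` (multiplicity one), we have
`χ(1) · Σ_h χ(h⁻¹) χ_V(gh) = |G| · χ(g)`: `P = (χ(1)∕|G|) z_χ` is an idempotent intertwiner of `V` whose range is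
isomorphic to `U` (injectivity by irreducibility, dimensions by traces), and `tr(ρ_V(g) P) = χ_{range P}(g)`.
[cite: SerreLinearRepresentations1977, §2.6 Thm. 8] (proved here without decomposing `V`). -/
theorem beta_sum [ρU.IsIrreducible] (hE : finrank k (IntertwiningMap ρU ρU) = 1)
    (hnorm : ∑ g, ρU.character g * ρU.character g⁻¹ = Fintype.card G)
    {V : Type*} [AddCommGroup V] [Module k V] [FiniteDimensional k V] (ρV : Representation k G V)
    (hm : ∑ h, ρU.character h⁻¹ * ρV.character h = Fintype.card G) (g : G) :
    ρU.character 1 * ∑ h, ρU.character h⁻¹ * ρV.character (g * h) = Fintype.card G * ρU.character g := by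
  haveI : Nontrivial U := nontrivial_of_finrank_intertwiningMap_eq_one ρU hE
  set f : G → k := ρU.character with hfdef
  set N : k := (Fintype.card G : k) with hNdef
  have hN : N ≠ 0 := by rw [hNdef]; exact_mod_cast Fintype.card_ne_zero
  have hcl : ∀ a b, f (a * b) = f (b * a) := char_mul_comm' ρU
  have hf1 : f 1 = finrank k U := char_one ρU
  have hf1' : f 1 ≠ 0 := by
    rw [hf1]
    exact_mod_cast (Module.finrank_pos (R := k) (M := U)).ne'
  -- (α) divided through
  set c : k := N / f 1 with hcdef
  have hα : ∀ x, ∑ h, f h⁻¹ * f (h * x) = c * f x := fun x => by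
    have := alpha_sum ρU hE hnorm x
    rw [hcdef, div_mul_eq_mul_div, eq_div_iff hf1', mul_comm _ (f 1)]
    exact this
  -- the class operator on `V` and its square
  set Z : Module.End k V := ∑ h, f h⁻¹ • ρV h with hZdef
  have hZZ : Z * Z = c • Z := by
    have e1 : Z * Z = ∑ h, ∑ x, (f h⁻¹ * f (x⁻¹ * h)) • ρV x := by
      rw [hZdef, Finset.sum_mul_sum]
      refine Finset.sum_congr rfl (fun h _ => ?_)
      refine Fintype.sum_equiv (Equiv.mulLeft h) _ _ (fun h' => ?_)
      simp only [Equiv.coe_mulLeft, smul_mul_assoc, mul_smul_comm, smul_smul, ← map_mul, mul_inv_rev,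
        inv_mul_cancel_right]
      rw [mul_comm]
    have e2 : ∑ h, ∑ x, (f h⁻¹ * f (x⁻¹ * h)) • ρV x = ∑ x, (∑ h, f h⁻¹ * f (x⁻¹ * h)) • ρV x := by
      rw [Finset.sum_comm]
      exact Finset.sum_congr rfl (fun x _ => (Finset.sum_smul).symm)
    have e3 : ∀ x, ∑ h, f h⁻¹ * f (x⁻¹ * h) = c * f x⁻¹ := fun x => by
      rw [← hα x⁻¹]
      exact Finset.sum_congr rfl (fun h _ => by rw [hcl])
    rw [e1, e2]
    simp only [e3, ← smul_smul, ← Finset.smul_sum]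
    rw [hZdef]
  -- the projector
  set a : k := f 1 / N with hadef
  have hac : a * c = 1 := by
    rw [hadef, hcdef, div_mul_div_comm, mul_comm (f 1) N, div_self (mul_ne_zero hN hf1')]
  set P : IntertwiningMap ρV ρV := a • classOp ρV f hcl with hPdef
  have hP : P.toLinearMap = a • Z := by rw [hPdef, IntertwiningMap.toLinearMap_smul, classOp_toLinearMap]
  have hPP : P.toLinearMap * P.toLinearMap = P.toLinearMap := by
    rw [hP, smul_mul_smul_comm, hZZ, smul_smul, mul_assoc, hac, mul_one]
  have hPPv : ∀ v, P (P v) = P v := fun v => by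
    have := congrArg (fun F : Module.End k V => F v) hPP
    simpa only [Module.End.mul_apply, IntertwiningMap.coe_toLinearMap] using this
  -- `U' = range P`, its character is `tr(ρ_V(y) P)`
  have hmem : ∀ y v, (ρV y * P.toLinearMap) v ∈ P.range.toSubmodule := fun y v =>
    P.range.apply_mem_toSubmodule y ⟨v, rfl⟩
  have hχU' : ∀ y, P.range.toRepresentation.character y = LinearMap.trace k V (ρV y * P.toLinearMap) := fun y => by
    rw [← LinearMap.trace_restrict_eq_of_forall_mem P.range.toSubmodule (ρV y * P.toLinearMap) (hmem y)]
    unfold Representation.character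
    congr 1
    apply LinearMap.ext
    rintro ⟨w, ⟨v, rfl⟩⟩
    apply Subtype.ext
    simp only [LinearMap.coe_restrict_apply, Module.End.mul_apply, IntertwiningMap.coe_toLinearMap]
    show ρV y (P.toLinearMap v) = ρV y (P (P.toLinearMap v))
    rw [IntertwiningMap.coe_toLinearMap, hPPv]
  -- `tr(ρ_V(y) P) = a Σ_h f(h⁻¹) χ_V(yh)`
  have htrP : ∀ y, LinearMap.trace k V (ρV y * P.toLinearMap) = a * ∑ h, f h⁻¹ * ρV.character (y * h) := fun y => by
    rw [hP, mul_smul_comm, map_smul, hZdef, trace_mul_classSum, smul_eq_mul]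
  have htrP1 : LinearMap.trace k V P.toLinearMap = f 1 := by
    have h1 := htrP 1
    simp only [map_one, one_mul] at h1
    rw [h1, hm, hadef, div_mul_cancel₀ _ hN]
  -- dimension of `U'`
  have hdimU' : (finrank k P.range.toSubmodule : k) = f 1 := by
    rw [← char_one P.range.toRepresentation, hχU' 1, map_one ρV, one_mul, htrP1]
  have hdimeq : finrank k U = finrank k P.range.toSubmodule := by
    have : (finrank k U : k) = finrank k P.range.toSubmodule := by rw [hdimU', hf1]
    exact_mod_cast this
  -- `⟨χ_{U'}, χ_U⟩ = 1`
  have hZP : Z = c • P.toLinearMap := by rw [hP, smul_smul, mul_comm, hac, one_smul]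
  have hinner : ∑ y, P.range.toRepresentation.character y * f y⁻¹ = N := by
    calc ∑ y, P.range.toRepresentation.character y * f y⁻¹
        = LinearMap.trace k V (∑ y, f y⁻¹ • (ρV y * P.toLinearMap)) := by
          rw [map_sum]
          exact Finset.sum_congr rfl (fun y _ => by rw [map_smul, smul_eq_mul, hχU' y, mul_comm])
      _ = LinearMap.trace k V (Z * P.toLinearMap) := by
          simp only [hZdef, Finset.sum_mul, smul_mul_assoc]
      _ = N := by
          rw [hZP, smul_mul_assoc, hPP, map_smul, smul_eq_mul, htrP1, hcdef, div_mul_cancel₀ _ hf1']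
  have hhom : finrank k (IntertwiningMap ρU P.range.toRepresentation) = 1 := by
    have h := sum_char_mul_char_inv ρU P.range.toRepresentation
    rw [hinner] at h
    have h' : (N : k) * 1 = N * finrank k (IntertwiningMap ρU P.range.toRepresentation) := by rw [mul_one]; exact h
    have := mul_left_cancel₀ hN h'
    exact_mod_cast this.symm
  -- a non-zero intertwiner `θ : U → U'`, injective by irreducibility, bijective by dimension
  obtain ⟨θ, hθ⟩ : ∃ θ : IntertwiningMap ρU P.range.toRepresentation, θ ≠ 0 := by
    by_contra hne
    push Not at hne
    have := (finrank_zero_iff_forall_zero (K := k)).mpr hne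
    omega
  have hinj : Function.Injective θ := (IsIrreducible.injective_or_eq_zero θ).resolve_right hθ
  have hsurj : Function.Surjective θ := by
    have := (LinearMap.injective_iff_surjective_of_finrank_eq_finrank hdimeq (f := θ.toLinearMap)).mp hinj
    exact this
  have hiso := char_iso (IntertwiningMap.ofBijective θ ⟨hinj, hsurj⟩)
  -- conclude
  have hfg : ρU.character g = a * ∑ h, f h⁻¹ * ρV.character (g * h) := by
    rw [← htrP g, ← hχU' g, hiso]
  have hNa : N * a = f 1 := by rw [hadef, ← mul_div_assoc, mul_div_cancel_left₀ _ hN]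
  show f 1 * _ = N * ρU.character g
  rw [hfg, ← mul_assoc, hNa]

end sums

end Summit.BirchSwinnertonDyer.BirchSwinnertonDyer.Theorems.CartanSupply.VirtualCharacter

end
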